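import Summits.Ventures.HodgeRepro2.T5InertDegreeAdicCompletion
import Summits.Ventures.HodgeRepro2.T5ConcretePlaces

/-!
# A concrete inert place with the degrees as numerals: `ℚ(ζ₃)/ℚ` at `2`, `deg T₁ = 18`
(cell pub-hodge-repro2, seat p3)

Tier-5 N3 support — the non-vacuity witness (README §10.5 (ii)(c)/(d)) for the inert-place hypothesis set of
files 195–207: on seat p4's concrete inert place (`T5EisensteinInertPlace`: `K = ℚ`, `L = ℚ(ζ₃)`, `v = v₂` the
place at `2`, `w` ANY place of `L` above `v₂` — one exists — where `2` stays a uniformiser of `O_{L_w}`,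
`[L_w : K_v] = 2`, `e(w/v) = 1`), with `N(v₂) = 2`:

* `absNorm_v₂` — `N(v₂) = #(ℤ/2) = 2` (`v₂ = (2)`, `Ideal.absNorm_span_singleton`, `Algebra.norm_algebraMap`);
* **`card_traceZero_eq_two`** — the trace-zero part of the residue field `𝔽₄` of `𝒪_{E_v}` has `2` elements;
* **`ncard_orbit_cellU_eq`** — `deg Tₙ = #(K aₙ K / K) = 9 · 2^{4n−3}` (`n ≥ 1`);
* **`ncard_orbit_cellU_one`** — `deg T₁ = 18` (and `deg T₂ = 288`: `ncard_orbit_cellU_two`);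
* **`mul_cellU_eq`** / **`mul_cellU_one_eq`** — the tree recursion `T₁ T_{n+2} = T_{n+3} + T_{n+2} + 16 T_{n+1}`,
  `T₁² = T₂ + T₁ + 18 T₀` of `H(U(antidiag(1, u, 1)), K)` for `u ∈ ℤ₂ˣ`;
* `hypotheses_satisfiable` — a star equal to a non-trivial `σ ∈ Gal(L_w/K_v)` exists (p8's `starRingOfQuadratic`),
  so the hypothesis set `(σ, hst, hσ)` of file 207 is inhabited on this place;
* `ncard_orbit_cellU_one_eq_eighteen` — `deg T₁ = 18` with every instance hypothesis discharged in the statement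
  (`haveI`), for `u = 1`.

Mathlib + this seat's file 207 + p4's T5ConcretePlaces / T5EisensteinInertPlace / T5GaussianPlace and their imports;
no display; no device. §8(d): uses an L-value-free non-vanishing device: NO.
-/

namespace Summit.Ventures.HodgeRepro2.T5InertDegreeToy

open IsDedekindDomain HeightOneSpectrum NumberField
open Summit.Ventures.HodgeRepro2.T5HermitianThreeElements Summit.Ventures.HodgeRepro2.T5UnitaryGroupForm
  Summit.Ventures.HodgeRepro2.T5UnitaryHeckeAdjoint Summit.Ventures.HodgeRepro2.T5HeckeBasisCells
  Summit.Ventures.HodgeRepro2.T5GaloisCartanThree Summit.Ventures.HodgeRepro2.T5InertUnipotentResidue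
  Summit.Ventures.HodgeRepro2.T5InertDegreeGalois Summit.Ventures.HodgeRepro2.T5InertPlaceCompletion
  Summit.Ventures.HodgeRepro2.T5InertPlaceCompletionCells Summit.Ventures.HodgeRepro2.T5InertDegreeAdicCompletion
  Summit.Ventures.HodgeRepro2.T5GaussianField Summit.Ventures.HodgeRepro2.T5EisensteinField
  Summit.Ventures.HodgeRepro2.T5EisensteinInertPlace Summit.Ventures.HodgeRepro2.T5GaussianPlace

/-- `N(v₂) = 2`. -/
theorem absNorm_v₂ : Ideal.absNorm v₂.asIdeal = 2 := by
  rw [asIdeal_v₂, Ideal.absNorm_span_singleton]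
  have h : (2 : RingOfIntegers ℚ) = algebraMap ℤ (RingOfIntegers ℚ) 2 := by simp
  rw [h, Algebra.norm_algebraMap, NumberField.RingOfIntegers.rank, Module.finrank_self]
  norm_num

section Abstract

variable {k A : Type*} [Field k] [Mul A] [Add A] [SMul k A]

/-- Evaluating the scalars of the three-term recursion at `q = 2` (a `rw` inside the `heckeBasisCells` terms times
out at `isDefEq`; the abstract form is instantiated in term mode). -/
theorem recursion_numeral_congr (h1 : ∀ x : A, (1 : k) • x = x) {T₁ T₂ T₃ T₄ : A} {q : k} (hq1 : q - 1 = 1)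
    (hq4 : q ^ 4 = 16) (h : T₁ * T₂ = T₃ + (q - 1) • T₂ + q ^ 4 • T₄) :
    T₁ * T₂ = T₃ + T₂ + (16 : k) • T₄ := by
  rw [hq1, hq4, h1] at h; exact h

/-- The same at `n = 0` (`q⁴ + q = 18`). -/
theorem recursion_zero_numeral_congr (h1 : ∀ x : A, (1 : k) • x = x) {T₁ T₂ T₃ T₄ : A} {q : k}
    (hq1 : q - 1 = 1) (hq : q ^ 4 + q = 18) (h : T₁ * T₂ = T₃ + (q - 1) • T₂ + (q ^ 4 + q) • T₄) :
    T₁ * T₂ = T₃ + T₂ + (18 : k) • T₄ := by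
  rw [hq1, hq, h1] at h; exact h

end Abstract

section Place

variable (w : HeightOneSpectrum (RingOfIntegers L₃)) [w.asIdeal.LiesOver v₂.asIdeal]

/-- `e(w/v₂) = 1` (p4's T5ConcretePlaces). -/
theorem ramificationIdx'_eq_one : v₂.asIdeal.ramificationIdx' w.asIdeal = 1 :=
  Summit.Ventures.HodgeRepro2.T5ConcretePlaces.ramificationIdx'.2.2 w

variable [IsDiscreteValuationRing (integralClosure (v₂.adicCompletionIntegers ℚ) (w.adicCompletion L₃))]
  [Finite (IsLocalRing.ResidueField (integralClosure (v₂.adicCompletionIntegers ℚ) (w.adicCompletion L₃)))]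
  [IsFractionRing (integralClosure (v₂.adicCompletionIntegers ℚ) (w.adicCompletion L₃)) (w.adicCompletion L₃)]
  [StarRing (w.adicCompletion L₃)]
  (σ : (w.adicCompletion L₃) ≃ₐ[v₂.adicCompletion ℚ] (w.adicCompletion L₃))
  (hst : ∀ x : w.adicCompletion L₃, star x = σ x) (hσ : σ ≠ 1)

include hst hσ in
/-- **`q = 2`**: the trace-zero part of the residue field `𝔽₄` of `𝒪_{E_v}` has two elements. -/
theorem card_traceZero_eq_two :
    Nat.card (traceZero (integralClosure (v₂.adicCompletionIntegers ℚ) (w.adicCompletion L₃))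
      (w.adicCompletion L₃)) = 2 :=
  (card_traceZero_eq_absNorm v₂ w σ hst (ramificationIdx'_eq_one w) (finrank_eq_two w) hσ irreducible_two
    (irreducible_algebraMap_two w)).trans absNorm_v₂

include hst hσ in
/-- **`deg Tₙ = 9 · 2^{4n−3}`** (`n ≥ 1`) for `U(antidiag(1, u, 1))` at the place `2` of `ℚ(ζ₃)`. -/
theorem ncard_orbit_cellU_eq (u : (v₂.adicCompletionIntegers ℚ)ˣ) (n : ℕ) (hn : 1 ≤ n) :
    (MulAction.orbit (hyperspecialSubgroup (integralClosure (v₂.adicCompletionIntegers ℚ) (w.adicCompletion L₃))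
          (J3 (algebraMap (v₂.adicCompletionIntegers ℚ) (w.adicCompletion L₃) (u : v₂.adicCompletionIntegers ℚ))))
        ((cellU (irreducible_uniformiser (map_maximalIdeal_integralClosure_eq_of_irreducible v₂ w irreducible_two
              (irreducible_algebraMap_two w)) irreducible_two)
            (star_algebraMap_of_star_eq σ hst (2 : v₂.adicCompletionIntegers ℚ))
            (algebraMap (v₂.adicCompletionIntegers ℚ) (w.adicCompletion L₃) (u : v₂.adicCompletionIntegers ℚ)) n :
              formUnitaryGroup (J3 (algebraMap (v₂.adicCompletionIntegers ℚ) (w.adicCompletion L₃)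
                (u : v₂.adicCompletionIntegers ℚ)))) :
          formUnitaryGroup (J3 (algebraMap (v₂.adicCompletionIntegers ℚ) (w.adicCompletion L₃)
              (u : v₂.adicCompletionIntegers ℚ))) ⧸
            hyperspecialSubgroup (integralClosure (v₂.adicCompletionIntegers ℚ) (w.adicCompletion L₃))
              (J3 (algebraMap (v₂.adicCompletionIntegers ℚ) (w.adicCompletion L₃)
                (u : v₂.adicCompletionIntegers ℚ))))).ncard = 9 * 2 ^ (4 * n - 3) :=
  (ncard_orbit_cellU_eq_adicCompletion v₂ w σ hst (ramificationIdx'_eq_one w) (finrank_eq_two w) hσ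
    irreducible_two (irreducible_algebraMap_two w) u n hn).trans (by rw [absNorm_v₂]; norm_num)

include hst hσ in
/-- **`deg T₁ = 18`** at the place `2` of `ℚ(ζ₃)`. -/
theorem ncard_orbit_cellU_one (u : (v₂.adicCompletionIntegers ℚ)ˣ) :
    (MulAction.orbit (hyperspecialSubgroup (integralClosure (v₂.adicCompletionIntegers ℚ) (w.adicCompletion L₃))
          (J3 (algebraMap (v₂.adicCompletionIntegers ℚ) (w.adicCompletion L₃) (u : v₂.adicCompletionIntegers ℚ))))
        ((cellU (irreducible_uniformiser (map_maximalIdeal_integralClosure_eq_of_irreducible v₂ w irreducible_two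
              (irreducible_algebraMap_two w)) irreducible_two)
            (star_algebraMap_of_star_eq σ hst (2 : v₂.adicCompletionIntegers ℚ))
            (algebraMap (v₂.adicCompletionIntegers ℚ) (w.adicCompletion L₃) (u : v₂.adicCompletionIntegers ℚ)) 1 :
              formUnitaryGroup (J3 (algebraMap (v₂.adicCompletionIntegers ℚ) (w.adicCompletion L₃)
                (u : v₂.adicCompletionIntegers ℚ)))) :
          formUnitaryGroup (J3 (algebraMap (v₂.adicCompletionIntegers ℚ) (w.adicCompletion L₃)
              (u : v₂.adicCompletionIntegers ℚ))) ⧸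
            hyperspecialSubgroup (integralClosure (v₂.adicCompletionIntegers ℚ) (w.adicCompletion L₃))
              (J3 (algebraMap (v₂.adicCompletionIntegers ℚ) (w.adicCompletion L₃)
                (u : v₂.adicCompletionIntegers ℚ))))).ncard = 18 :=
  ncard_orbit_cellU_eq w σ hst hσ u 1 le_rfl

include hst hσ in
/-- **`deg T₂ = 288`** at the place `2` of `ℚ(ζ₃)`. -/
theorem ncard_orbit_cellU_two (u : (v₂.adicCompletionIntegers ℚ)ˣ) :
    (MulAction.orbit (hyperspecialSubgroup (integralClosure (v₂.adicCompletionIntegers ℚ) (w.adicCompletion L₃))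
          (J3 (algebraMap (v₂.adicCompletionIntegers ℚ) (w.adicCompletion L₃) (u : v₂.adicCompletionIntegers ℚ))))
        ((cellU (irreducible_uniformiser (map_maximalIdeal_integralClosure_eq_of_irreducible v₂ w irreducible_two
              (irreducible_algebraMap_two w)) irreducible_two)
            (star_algebraMap_of_star_eq σ hst (2 : v₂.adicCompletionIntegers ℚ))
            (algebraMap (v₂.adicCompletionIntegers ℚ) (w.adicCompletion L₃) (u : v₂.adicCompletionIntegers ℚ)) 2 :
              formUnitaryGroup (J3 (algebraMap (v₂.adicCompletionIntegers ℚ) (w.adicCompletion L₃)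
                (u : v₂.adicCompletionIntegers ℚ)))) :
          formUnitaryGroup (J3 (algebraMap (v₂.adicCompletionIntegers ℚ) (w.adicCompletion L₃)
              (u : v₂.adicCompletionIntegers ℚ))) ⧸
            hyperspecialSubgroup (integralClosure (v₂.adicCompletionIntegers ℚ) (w.adicCompletion L₃))
              (J3 (algebraMap (v₂.adicCompletionIntegers ℚ) (w.adicCompletion L₃)
                (u : v₂.adicCompletionIntegers ℚ))))).ncard = 288 :=
  ncard_orbit_cellU_eq w σ hst hσ u 2 (by norm_num)

variable (k : Type*) [Field k] [CharZero k]

include hst hσ in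
/-- **The tree recursion at the place `2` of `ℚ(ζ₃)`**: `T₁ · T_{n+2} = T_{n+3} + T_{n+2} + 16 T_{n+1}`. -/
theorem mul_cellU_eq (u : (v₂.adicCompletionIntegers ℚ)ˣ) (n : ℕ) :
    heckeBasisCells (hstar_of_star_eq σ hst)
          (algebraMap (v₂.adicCompletionIntegers ℚ) (w.adicCompletion L₃) (u : v₂.adicCompletionIntegers ℚ))
          (star_algebraMap_of_star_eq σ hst (u : v₂.adicCompletionIntegers ℚ))
          (algebraMap_unit_ne_zero (F := v₂.adicCompletion ℚ) u)
          (isInteger_algebraMap (u : v₂.adicCompletionIntegers ℚ)) (isInteger_algebraMap_unit_inv u)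
          (irreducible_uniformiser (map_maximalIdeal_integralClosure_eq_of_irreducible v₂ w irreducible_two
            (irreducible_algebraMap_two w)) irreducible_two)
          (star_algebraMap_of_star_eq σ hst (2 : v₂.adicCompletionIntegers ℚ)) k 1 *
        heckeBasisCells (hstar_of_star_eq σ hst)
          (algebraMap (v₂.adicCompletionIntegers ℚ) (w.adicCompletion L₃) (u : v₂.adicCompletionIntegers ℚ))
          (star_algebraMap_of_star_eq σ hst (u : v₂.adicCompletionIntegers ℚ))
          (algebraMap_unit_ne_zero (F := v₂.adicCompletion ℚ) u)
          (isInteger_algebraMap (u : v₂.adicCompletionIntegers ℚ)) (isInteger_algebraMap_unit_inv u)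
          (irreducible_uniformiser (map_maximalIdeal_integralClosure_eq_of_irreducible v₂ w irreducible_two
            (irreducible_algebraMap_two w)) irreducible_two)
          (star_algebraMap_of_star_eq σ hst (2 : v₂.adicCompletionIntegers ℚ)) k (n + 1 + 1) =
      heckeBasisCells (hstar_of_star_eq σ hst)
          (algebraMap (v₂.adicCompletionIntegers ℚ) (w.adicCompletion L₃) (u : v₂.adicCompletionIntegers ℚ))
          (star_algebraMap_of_star_eq σ hst (u : v₂.adicCompletionIntegers ℚ))
          (algebraMap_unit_ne_zero (F := v₂.adicCompletion ℚ) u)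
          (isInteger_algebraMap (u : v₂.adicCompletionIntegers ℚ)) (isInteger_algebraMap_unit_inv u)
          (irreducible_uniformiser (map_maximalIdeal_integralClosure_eq_of_irreducible v₂ w irreducible_two
            (irreducible_algebraMap_two w)) irreducible_two)
          (star_algebraMap_of_star_eq σ hst (2 : v₂.adicCompletionIntegers ℚ)) k (n + 1 + 1 + 1) +
        heckeBasisCells (hstar_of_star_eq σ hst)
          (algebraMap (v₂.adicCompletionIntegers ℚ) (w.adicCompletion L₃) (u : v₂.adicCompletionIntegers ℚ))
          (star_algebraMap_of_star_eq σ hst (u : v₂.adicCompletionIntegers ℚ))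
          (algebraMap_unit_ne_zero (F := v₂.adicCompletion ℚ) u)
          (isInteger_algebraMap (u : v₂.adicCompletionIntegers ℚ)) (isInteger_algebraMap_unit_inv u)
          (irreducible_uniformiser (map_maximalIdeal_integralClosure_eq_of_irreducible v₂ w irreducible_two
            (irreducible_algebraMap_two w)) irreducible_two)
          (star_algebraMap_of_star_eq σ hst (2 : v₂.adicCompletionIntegers ℚ)) k (n + 1 + 1) +
        (16 : k) •
          heckeBasisCells (hstar_of_star_eq σ hst)
            (algebraMap (v₂.adicCompletionIntegers ℚ) (w.adicCompletion L₃) (u : v₂.adicCompletionIntegers ℚ))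
            (star_algebraMap_of_star_eq σ hst (u : v₂.adicCompletionIntegers ℚ))
            (algebraMap_unit_ne_zero (F := v₂.adicCompletion ℚ) u)
            (isInteger_algebraMap (u : v₂.adicCompletionIntegers ℚ)) (isInteger_algebraMap_unit_inv u)
            (irreducible_uniformiser (map_maximalIdeal_integralClosure_eq_of_irreducible v₂ w irreducible_two
              (irreducible_algebraMap_two w)) irreducible_two)
            (star_algebraMap_of_star_eq σ hst (2 : v₂.adicCompletionIntegers ℚ)) k (n + 1) :=
  recursion_numeral_congr (one_smul k) (by rw [absNorm_v₂]; norm_num) (by rw [absNorm_v₂]; norm_num)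
    (mul_cellU_eq_adicCompletion v₂ w σ hst (ramificationIdx'_eq_one w) (finrank_eq_two w) hσ
      irreducible_two (irreducible_algebraMap_two w) k u n)

include hst hσ in
/-- **The tree recursion at `n = 0`, place `2` of `ℚ(ζ₃)`**: `T₁² = T₂ + T₁ + 18 T₀`. -/
theorem mul_cellU_one_eq (u : (v₂.adicCompletionIntegers ℚ)ˣ) :
    heckeBasisCells (hstar_of_star_eq σ hst)
          (algebraMap (v₂.adicCompletionIntegers ℚ) (w.adicCompletion L₃) (u : v₂.adicCompletionIntegers ℚ))
          (star_algebraMap_of_star_eq σ hst (u : v₂.adicCompletionIntegers ℚ))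
          (algebraMap_unit_ne_zero (F := v₂.adicCompletion ℚ) u)
          (isInteger_algebraMap (u : v₂.adicCompletionIntegers ℚ)) (isInteger_algebraMap_unit_inv u)
          (irreducible_uniformiser (map_maximalIdeal_integralClosure_eq_of_irreducible v₂ w irreducible_two
            (irreducible_algebraMap_two w)) irreducible_two)
          (star_algebraMap_of_star_eq σ hst (2 : v₂.adicCompletionIntegers ℚ)) k 1 *
        heckeBasisCells (hstar_of_star_eq σ hst)
          (algebraMap (v₂.adicCompletionIntegers ℚ) (w.adicCompletion L₃) (u : v₂.adicCompletionIntegers ℚ))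
          (star_algebraMap_of_star_eq σ hst (u : v₂.adicCompletionIntegers ℚ))
          (algebraMap_unit_ne_zero (F := v₂.adicCompletion ℚ) u)
          (isInteger_algebraMap (u : v₂.adicCompletionIntegers ℚ)) (isInteger_algebraMap_unit_inv u)
          (irreducible_uniformiser (map_maximalIdeal_integralClosure_eq_of_irreducible v₂ w irreducible_two
            (irreducible_algebraMap_two w)) irreducible_two)
          (star_algebraMap_of_star_eq σ hst (2 : v₂.adicCompletionIntegers ℚ)) k (0 + 1) =
      heckeBasisCells (hstar_of_star_eq σ hst)
          (algebraMap (v₂.adicCompletionIntegers ℚ) (w.adicCompletion L₃) (u : v₂.adicCompletionIntegers ℚ))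
          (star_algebraMap_of_star_eq σ hst (u : v₂.adicCompletionIntegers ℚ))
          (algebraMap_unit_ne_zero (F := v₂.adicCompletion ℚ) u)
          (isInteger_algebraMap (u : v₂.adicCompletionIntegers ℚ)) (isInteger_algebraMap_unit_inv u)
          (irreducible_uniformiser (map_maximalIdeal_integralClosure_eq_of_irreducible v₂ w irreducible_two
            (irreducible_algebraMap_two w)) irreducible_two)
          (star_algebraMap_of_star_eq σ hst (2 : v₂.adicCompletionIntegers ℚ)) k (0 + 1 + 1) +
        heckeBasisCells (hstar_of_star_eq σ hst)
          (algebraMap (v₂.adicCompletionIntegers ℚ) (w.adicCompletion L₃) (u : v₂.adicCompletionIntegers ℚ))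
          (star_algebraMap_of_star_eq σ hst (u : v₂.adicCompletionIntegers ℚ))
          (algebraMap_unit_ne_zero (F := v₂.adicCompletion ℚ) u)
          (isInteger_algebraMap (u : v₂.adicCompletionIntegers ℚ)) (isInteger_algebraMap_unit_inv u)
          (irreducible_uniformiser (map_maximalIdeal_integralClosure_eq_of_irreducible v₂ w irreducible_two
            (irreducible_algebraMap_two w)) irreducible_two)
          (star_algebraMap_of_star_eq σ hst (2 : v₂.adicCompletionIntegers ℚ)) k (0 + 1) +
        (18 : k) •
          heckeBasisCells (hstar_of_star_eq σ hst)
            (algebraMap (v₂.adicCompletionIntegers ℚ) (w.adicCompletion L₃) (u : v₂.adicCompletionIntegers ℚ))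
            (star_algebraMap_of_star_eq σ hst (u : v₂.adicCompletionIntegers ℚ))
            (algebraMap_unit_ne_zero (F := v₂.adicCompletion ℚ) u)
            (isInteger_algebraMap (u : v₂.adicCompletionIntegers ℚ)) (isInteger_algebraMap_unit_inv u)
            (irreducible_uniformiser (map_maximalIdeal_integralClosure_eq_of_irreducible v₂ w irreducible_two
              (irreducible_algebraMap_two w)) irreducible_two)
            (star_algebraMap_of_star_eq σ hst (2 : v₂.adicCompletionIntegers ℚ)) k 0 :=
  recursion_zero_numeral_congr (one_smul k) (by rw [absNorm_v₂]; norm_num) (by rw [absNorm_v₂]; norm_num)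
    (mul_cellU_one_eq_adicCompletion v₂ w σ hst (ramificationIdx'_eq_one w) (finrank_eq_two w) hσ
      irreducible_two (irreducible_algebraMap_two w) k u)

end Place

section Satisfiable

variable (w : HeightOneSpectrum (RingOfIntegers L₃)) [w.asIdeal.LiesOver v₂.asIdeal]

/-- **The hypothesis set is inhabited**: a star on `L_w` equal to a non-trivial `σ ∈ Gal(L_w/K_v)` exists
(p8's `starRingOfQuadratic`), with the three instance hypotheses on `𝒪_{E_v}` (p8's T5-146 / T5-149, Mathlib). -/
theorem hypotheses_satisfiable :
    IsDiscreteValuationRing (integralClosure (v₂.adicCompletionIntegers ℚ) (w.adicCompletion L₃)) ∧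
    (haveI := isDiscreteValuationRing_integralClosure_adicCompletion v₂ w;
      Finite (IsLocalRing.ResidueField (integralClosure (v₂.adicCompletionIntegers ℚ) (w.adicCompletion L₃)))) ∧
    IsFractionRing (integralClosure (v₂.adicCompletionIntegers ℚ) (w.adicCompletion L₃)) (w.adicCompletion L₃) ∧
    ∃ S : StarRing (w.adicCompletion L₃), ∃ σ : (w.adicCompletion L₃) ≃ₐ[v₂.adicCompletion ℚ] (w.adicCompletion L₃),
      σ ≠ 1 ∧ (letI := S; ∀ x : w.adicCompletion L₃, star x = σ x) := by
  obtain ⟨σ, hσ⟩ := exists_algEquiv_ne_one w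
  exact ⟨isDiscreteValuationRing_integralClosure_adicCompletion v₂ w,
    finite_residueField_integralClosure_adicCompletion v₂ w,
    integralClosure.isFractionRing_of_finite_extension (v₂.adicCompletion ℚ) (w.adicCompletion L₃),
    T5StarOfInvolution.starRingOfQuadratic (finrank_eq_two w) σ hσ, σ, hσ,
    fun x => T5StarOfInvolution.star_eq _ _ x⟩

end Satisfiable

end Summit.Ventures.HodgeRepro2.T5InertDegreeToy
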